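import Mathlib.Topology.DenseEmbedding
import Mathlib.Topology.Algebra.OpenSubgroup
import Mathlib.GroupTheory.GroupAction.ConjAct
import Mathlib.Tactic.Group
import Literature.AnabelianGeometry.AbsoluteAnabelian.AbsTopI.CoFreeCompletion
import HarnessLib

/-!
# [AbsTopI] §0 p. 8, continued: density of `Π → Π^{Q/co-fr}`, the printed form of `Ĥ^{co-fr}_Q`,
# and the maximal pro-`l` variant `J[l]`

S. Mochizuki, *Topics in Absolute Anabelian Geometry I* [AbsTopI] (2012), §0 p. 8 (manuscript
pagination, lit key `paper:url-11ac98ba15fc`); Prop 4.10 (iv) p. 60 ("write `J → J[l]` for the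
co-free completion of `J` with respect to the maximal pro-`l` quotient of the profinite completion of
`J`").  Companion (proofs + two further definitions) to `AbsTopI/CoFreeCompletion.lean`:

* `denseRange_toCoFreeCompletion` — "Thus, we have a natural DENSE homomorphism `Π → Π^{Q/co-fr}`"
  (p. 8), PROVED: the index set is directed and every coordinate of a point of the limit is hit by
  some element of `Π`, which then agrees with the point on every larger index;
* `Subgroup.Normal` of `(K.map ρ).topologicalClosure` for `K` normal in `Π` and `ρ` DENSE
  (`normal_topologicalClosure_map_of_denseRange`), whence
  `coFreeKernel_eq_topologicalClosure_map`: for dense `ρ` and `H^{co-fr}` normal in `Π` the subgroup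
  `coFreeKernel ρ H` of the construction IS the printed "`Ĥ^{co-fr}_Q` = image in `Q` of the closure of
  the image of `H^{co-fr}`" (the normal closure in its definition is then redundant);
* `cofreeCore_normal_of_charOpen` — for `Δ` normal in `Π` and `H` characteristic open in `Δ`,
  `H^{co-fr} = cofreeCore H` is normal in `Π` (conjugation restricts to a topological automorphism of
  `Δ`, hence preserves `H`, hence restricts to one of `H`, and the co-free core is characteristic);
* `proPrimeKer G l` / `MaxProQuot G l` — the maximal pro-`l` quotient of a topological group
  (quotient by the intersection of the open normal subgroups of `l`-power index), and
  `CoFreeProL ι l` := `J[l]`, the co-free completion of `J` with respect to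
  `J → Ĵ ↠ Ĵ^{(l)}` (for given profinite-completion data `ι : J → Ĵ`) and `Δ := J` (p. 60: "all
  co-free completions [...] will be with respect to [the intersections [...] with] `Δ^{tp}_X`";
  for `J ⊆ Δ^{tp}_X` that intersection is `J`).

HONEST FRAMING: general topology; nothing here bears on [IUTchIII] Cor 3.12.
-/

noncomputable section

open Topology Filter

universe u v w

namespace Literature.AnabelianGeometry.AbsoluteAnabelian.AbsTopI

variable {P : Type u} [Group P] [TopologicalSpace P]

/-! ### Density of the natural homomorphism -/

section Dense

variable {Q : Type v} [Group Q] [TopologicalSpace Q] [IsTopologicalGroup Q]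
  (ρ : P →ₜ* Q) (Δ : Subgroup P)

/-- **"a natural dense homomorphism `Π → Π^{Q/co-fr}`"** ([AbsTopI] §0 p. 8), PROVED for the
construction `toCoFreeCompletion`: given a point `x` of the limit, choose for every index `H` an
element `p_H ∈ Π` mapping to the coordinate `x_H`; along the directed index set (`H → −∞`, i.e.
`H` shrinking) the images of the `p_H` agree with `x` at every fixed coordinate `H₀` as soon as
`H ⊆ H₀` (compatibility of `x`), so they converge to `x`. [cite: MochizukiAbsTopI2012, §0 p.8] -/
theorem denseRange_toCoFreeCompletion : DenseRange (toCoFreeCompletion ρ Δ) := by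
  intro x
  rcases isEmpty_or_nonempty (CharOpenSubgroup Δ) with hE | hN
  · refine subset_closure ⟨1, ?_⟩
    ext H
    exact hE.elim H
  · choose u hu using fun H : CharOpenSubgroup Δ => x.exists_toCoFreeQuot_eq_val H
    -- (v2 topology: the initial topology of the `Π ⧸ K_{H₀}`-coordinates `kerCoord H₀`) at every
    -- fixed coordinate `H₀` the images of the `p_H` are EVENTUALLY EQUAL to `x`
    have ht : ∀ H₀ : CharOpenSubgroup Δ,
        Tendsto (fun H : CharOpenSubgroup Δ => CoFreeCompletion.kerCoord H₀ (toCoFreeCompletion ρ Δ (u H)))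
          atBot (𝓝 (CoFreeCompletion.kerCoord H₀ x)) := by
      intro H₀
      refine (tendsto_const_nhds (x := CoFreeCompletion.kerCoord H₀ x)).congr' ?_
      filter_upwards [Iic_mem_atBot H₀] with H hH
      rw [CoFreeCompletion.kerCoord_eq_iff]
      change x.val H₀ = toCoFreeQuot ρ H₀.toSubgroup (u H)
      rw [← transition_toCoFreeQuot ρ (hH : H ≤ H₀), hu H, x.transition_val]
    have ht' : Tendsto (fun H : CharOpenSubgroup Δ => toCoFreeCompletion ρ Δ (u H)) atBot
        (@nhds _ (⨅ H₀ : CharOpenSubgroup Δ, TopologicalSpace.induced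
          (CoFreeCompletion.kerCoord (ρ := ρ) (Δ := Δ) H₀) inferInstance) x) := by
      rw [nhds_iInf, tendsto_iInf]
      intro H₀
      rw [nhds_induced, tendsto_comap_iff]
      exact ht H₀
    exact mem_closure_of_tendsto ht' (Eventually.of_forall fun H => ⟨u H, rfl⟩)

/-- Density, pointwise form: every point of `Π^{Q/co-fr}` AGREES with the image of some element of
`Π` at any prescribed index (hence, by compatibility, at all larger ones).
[cite: MochizukiAbsTopI2012, §0 p.8] -/
theorem exists_val_toCoFreeCompletion_eq (x : CoFreeCompletion ρ Δ) (H : CharOpenSubgroup Δ) :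
    ∃ p : P, ∀ H₀ : CharOpenSubgroup Δ, H ≤ H₀ →
      (toCoFreeCompletion ρ Δ p).val H₀ = x.val H₀ := by
  obtain ⟨p, hp⟩ := x.exists_toCoFreeQuot_eq_val H
  refine ⟨p, fun H₀ h => ?_⟩
  change toCoFreeQuot ρ H₀.toSubgroup p = x.val H₀
  rw [← transition_toCoFreeQuot ρ (h : H ≤ H₀), hp, x.transition_val]

end Dense

/-! ### The printed form of `Ĥ^{co-fr}_Q`: closures of images of normal subgroups under dense maps -/

section NormalClosure

variable {Q : Type v} [Group Q] [TopologicalSpace Q] [IsTopologicalGroup Q] (ρ : P →ₜ* Q)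

/-- If `ρ : Π → Q` has DENSE image and `K` is normal in `Π`, then the closure of `ρ(K)` is normal in
`Q`: it is normalised by the dense subgroup `ρ(Π)`, and "`q` normalises the closed subgroup `N`" is
a closed condition on `q`.  (This is why, in [AbsTopI] §0 p. 8, `Q/Ĥ^{co-fr}_Q` is a group.)
[cite: MochizukiAbsTopI2012, §0 p.8] -/
theorem normal_topologicalClosure_map_of_denseRange (hρ : DenseRange ρ) (K : Subgroup P)
    [hK : K.Normal] : ((K.map ρ.toMonoidHom).topologicalClosure).Normal := by
  constructor
  intro n hn q
  -- closed condition in `q`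
  have hc : IsClosed {q : Q | q * n * q⁻¹ ∈ (K.map ρ.toMonoidHom).topologicalClosure} :=
    (Subgroup.isClosed_topologicalClosure _).preimage
      ((continuous_id.mul continuous_const).mul continuous_id.inv)
  refine hρ.induction_on q hc fun p => ?_
  -- for `q = ρ p`: conjugation by `ρ p` is a homeomorphism of `Q` preserving `ρ(K)`
  change ρ p * n * (ρ p)⁻¹ ∈ (K.map ρ.toMonoidHom).topologicalClosure
  have hcont : Continuous fun y : Q => ρ p * y * (ρ p)⁻¹ :=
    (continuous_const.mul continuous_id).mul continuous_const
  have himage : Set.MapsTo (fun y : Q => ρ p * y * (ρ p)⁻¹) (K.map ρ.toMonoidHom : Set Q)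
      (K.map ρ.toMonoidHom : Set Q) := by
    rintro _ ⟨k, hk, rfl⟩
    refine ⟨p * k * p⁻¹, hK.conj_mem k hk p, ?_⟩
    change ρ (p * k * p⁻¹) = ρ p * ρ k * (ρ p)⁻¹
    rw [map_mul, map_mul, map_inv]
  exact himage.closure hcont hn

/-- **The printed `Ĥ^{co-fr}_Q`.**  For dense `ρ` and `H^{co-fr}` (`= cofreeCore H`) normal in `Π`
(the printed situation: `H` characteristic open in the normal `Δ`, see
`cofreeCore_normal_of_charOpen`), the kernel of the construction is just the closure of the image:
`coFreeKernel ρ H = closure(ρ(H^{co-fr}))` — "the image in `Q` of the closure of the image of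
`H^{co-fr}`". [cite: MochizukiAbsTopI2012, §0 p.8] -/
theorem coFreeKernel_eq_topologicalClosure_map (hρ : DenseRange ρ) (H : Subgroup P)
    [(cofreeCore H).Normal] :
    coFreeKernel ρ H = ((cofreeCore H).map ρ.toMonoidHom).topologicalClosure := by
  haveI := normal_topologicalClosure_map_of_denseRange ρ hρ (cofreeCore H)
  refine le_antisymm ?_ ?_
  · refine Subgroup.topologicalClosure_minimal _ ?_ (Subgroup.isClosed_topologicalClosure _)
    refine Subgroup.normalClosure_le_normal ?_
    rintro _ ⟨k, hk, rfl⟩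
    exact Subgroup.le_topologicalClosure _ ⟨k, hk, rfl⟩
  · refine Subgroup.topologicalClosure_mono ?_
    rintro _ ⟨k, hk, rfl⟩
    exact Subgroup.subset_normalClosure ⟨k, hk, rfl⟩

end NormalClosure

/-! ### `H^{co-fr}` is normal in `Π` for `H` characteristic open in the normal `Δ` -/

section Normal

open Literature.AnabelianGeometry.EtaleTheta (IsCofree)

/-- The intrinsic co-free core of a topological group `G`: the intersection of its (normal, open)
co-free subgroups. [cite: MochizukiAbsTopI2012, §0 p.8] -/
def cofreeRadical (G : Type w) [Group G] [TopologicalSpace G] : Subgroup G :=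
  sInf {L : Subgroup G | ∃ hN : L.Normal, @IsCofree G _ _ L hN}

/-- A topological automorphism maps the intrinsic co-free core into itself (it permutes the
co-free subgroups, `IsCofree.map_continuousMulEquiv`). [cite: MochizukiAbsTopI2012, §0 p.8] -/
theorem cofreeRadical_map_le {G : Type w} [Group G] [TopologicalSpace G] (ψ : G ≃ₜ* G) :
    (cofreeRadical G).map ψ.toMulEquiv.toMonoidHom ≤ cofreeRadical G := by
  refine le_sInf fun L hL => ?_
  obtain ⟨hN, hcf⟩ := hL
  -- `L = ψ(ψ⁻¹(L))` and `ψ⁻¹(L)` is co-free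
  have hL' : (L.map ψ.symm.toMulEquiv.toMonoidHom) ∈
      {L : Subgroup G | ∃ hN : L.Normal, @IsCofree G _ _ L hN} :=
    ⟨_, hcf.map_continuousMulEquiv ψ.symm⟩
  have hle : cofreeRadical G ≤ L.map ψ.symm.toMulEquiv.toMonoidHom := sInf_le hL'
  calc (cofreeRadical G).map ψ.toMulEquiv.toMonoidHom
      ≤ (L.map ψ.symm.toMulEquiv.toMonoidHom).map ψ.toMulEquiv.toMonoidHom := Subgroup.map_mono hle
    _ = L := by
        rw [Subgroup.map_map]
        have hc : ψ.toMulEquiv.toMonoidHom.comp ψ.symm.toMulEquiv.toMonoidHom = MonoidHom.id G :=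
          MonoidHom.ext fun x => ψ.apply_symm_apply x
        rw [hc, Subgroup.map_id]

/-- "characteristic" ([AbsTopI] §0 p. 8): the intrinsic co-free core is carried onto itself by every
topological automorphism. [cite: MochizukiAbsTopI2012, §0 p.8] -/
theorem cofreeRadical_map_eq {G : Type w} [Group G] [TopologicalSpace G] (α : G ≃ₜ* G) :
    (cofreeRadical G).map α.toMulEquiv.toMonoidHom = cofreeRadical G := by
  refine le_antisymm (cofreeRadical_map_le α) ?_
  calc cofreeRadical G
      = ((cofreeRadical G).map α.symm.toMulEquiv.toMonoidHom).map α.toMulEquiv.toMonoidHom := by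
        rw [Subgroup.map_map]
        have hc : α.toMulEquiv.toMonoidHom.comp α.symm.toMulEquiv.toMonoidHom = MonoidHom.id G :=
          MonoidHom.ext fun x => α.apply_symm_apply x
        rw [hc, Subgroup.map_id]
    _ ≤ (cofreeRadical G).map α.toMulEquiv.toMonoidHom :=
        Subgroup.map_mono (cofreeRadical_map_le α.symm)

/-- The relative co-free core `cofreeCore H ⊆ Π`, pulled back into `H`, is the intrinsic co-free core
of the topological group `H`. [cite: MochizukiAbsTopI2012, §0 p.8] -/
theorem cofreeCore_subgroupOf_eq (H : Subgroup P) : (cofreeCore H).subgroupOf H = cofreeRadical H := by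
  apply le_antisymm
  · refine le_sInf fun L hL => ?_
    obtain ⟨hN, hcf⟩ := hL
    have hK : (L.map H.subtype).subgroupOf H = L :=
      Subgroup.comap_map_eq_self_of_injective H.subtype_injective L
    have hKc : IsCofreeIn H (L.map H.subtype) := by
      refine ⟨fun x hx => ?_, ?_⟩
      · obtain ⟨y, _, rfl⟩ := hx
        exact y.2
      · rw [hK]
        exact ⟨hN, hcf⟩
    calc (cofreeCore H).subgroupOf H ≤ (L.map H.subtype).subgroupOf H :=
          Subgroup.comap_mono (cofreeCore_le_of_isCofreeIn hKc)
      _ = L := hK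
  · intro x hx
    rw [Subgroup.mem_subgroupOf]
    refine ⟨x.2, ?_⟩
    refine Subgroup.mem_iInf.2 fun K => Subgroup.mem_iInf.2 fun hK => ?_
    have hle : cofreeRadical H ≤ K.subgroupOf H := sInf_le hK.2
    exact hle hx

variable [IsTopologicalGroup P]

/-- Conjugation by `g ∈ Π` restricted to a normal subgroup `N`, as a group automorphism of `N`.
[cite: MochizukiAbsTopI2012, §0 p.8] -/
def conjRestrictMulEquiv (N : Subgroup P) [N.Normal] (g : P) : N ≃* N where
  toFun x := ⟨g * x * g⁻¹, Subgroup.Normal.conj_mem ‹N.Normal› (x : P) x.2 g⟩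
  invFun x := ⟨g⁻¹ * x * g, by simpa using Subgroup.Normal.conj_mem ‹N.Normal› (x : P) x.2 g⁻¹⟩
  left_inv x := Subtype.ext (show g⁻¹ * (g * (x : P) * g⁻¹) * g = x by group)
  right_inv x := Subtype.ext (show g * (g⁻¹ * (x : P) * g) * g⁻¹ = x by group)
  map_mul' x y := Subtype.ext
    (show g * ((x : P) * y) * g⁻¹ = g * x * g⁻¹ * (g * y * g⁻¹) by group)

/-- Conjugation by `g ∈ Π` restricted to a normal subgroup `N`, as an automorphism of the
TOPOLOGICAL group `N`. [cite: MochizukiAbsTopI2012, §0 p.8] -/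
def conjRestrict (N : Subgroup P) [N.Normal] (g : P) : N ≃ₜ* N :=
  { conjRestrictMulEquiv N g with
    continuous_toFun :=
      ((continuous_const.mul continuous_subtype_val).mul continuous_const).subtype_mk _
    continuous_invFun :=
      ((continuous_const.mul continuous_subtype_val).mul continuous_const).subtype_mk _ }

/-- Formula for restricted conjugation. [cite: MochizukiAbsTopI2012, §0 p.8] -/
@[simp] theorem coe_conjRestrict (N : Subgroup P) [N.Normal] (g : P) (x : N) :
    ((conjRestrict N g x : N) : P) = g * x * g⁻¹ := rfl

/-- A subgroup `H ≤ N` characteristic for the topological group `N` (normal in `Π`) is normal in `Π`: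
conjugation restricts to a topological automorphism of `N`. [cite: MochizukiAbsTopI2012, §0 p.8] -/
theorem normal_of_map_conjRestrict_eq {N : Subgroup P} [N.Normal] {H : Subgroup P} (hle : H ≤ N)
    (hchar : ∀ α : N ≃ₜ* N, (H.subgroupOf N).map α.toMulEquiv.toMonoidHom = H.subgroupOf N) :
    H.Normal := by
  constructor
  intro x hx g
  have hmem : (⟨x, hle hx⟩ : N) ∈ H.subgroupOf N := by
    rw [Subgroup.mem_subgroupOf]
    exact hx
  have himg : conjRestrict N g ⟨x, hle hx⟩ ∈ (H.subgroupOf N).map (conjRestrict N g).toMulEquiv.toMonoidHom :=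
    ⟨_, hmem, rfl⟩
  rw [hchar] at himg
  rw [Subgroup.mem_subgroupOf] at himg
  exact himg

/-- A characteristic open subgroup `H` of finite index of the normal `Δ` is normal in `Π`.
[cite: MochizukiAbsTopI2012, §0 p.8] -/
theorem CharOpenSubgroup.normal {Δ : Subgroup P} [Δ.Normal] (H : CharOpenSubgroup Δ) :
    H.toSubgroup.Normal :=
  normal_of_map_conjRestrict_eq H.le H.map_eq

/-- **`H^{co-fr}` is normal in `Π`** for `Δ` normal in `Π` and `H` a characteristic open subgroup of
finite index of `Δ` ("any minimal co-free subgroup [...] is [...] characteristic", [AbsTopI] §0 p. 8,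
applied twice: `H` char in `Δ`, `H^{co-fr}` char in `H`).  Hence, for dense `ρ`, the printed
`Ĥ^{co-fr}_Q` is normal and `coFreeKernel ρ H` is literally the closure of the image of `H^{co-fr}`
(`coFreeKernel_eq_topologicalClosure_map`). [cite: MochizukiAbsTopI2012, §0 p.8] -/
theorem cofreeCore_normal_of_charOpen {Δ : Subgroup P} [Δ.Normal] (H : CharOpenSubgroup Δ) :
    (cofreeCore H.toSubgroup).Normal := by
  haveI := H.normal
  refine normal_of_map_conjRestrict_eq (cofreeCore_le H.toSubgroup) fun α => ?_
  rw [cofreeCore_subgroupOf_eq]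
  exact cofreeRadical_map_eq α

/-- The printed `Ĥ^{co-fr}_Q` for the printed data: `Δ` normal, `H` characteristic open of finite
index in `Δ`, `ρ` dense ⟹ `coFreeKernel ρ H = closure(ρ(H^{co-fr}))`.
[cite: MochizukiAbsTopI2012, §0 p.8] -/
theorem coFreeKernel_eq_of_charOpen {Q : Type v} [Group Q] [TopologicalSpace Q] [IsTopologicalGroup Q]
    (ρ : P →ₜ* Q) (hρ : DenseRange ρ) {Δ : Subgroup P} [Δ.Normal] (H : CharOpenSubgroup Δ) :
    coFreeKernel ρ H.toSubgroup =
      ((cofreeCore H.toSubgroup).map ρ.toMonoidHom).topologicalClosure := by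
  haveI := cofreeCore_normal_of_charOpen H
  exact coFreeKernel_eq_topologicalClosure_map ρ hρ H.toSubgroup

end Normal

/-! ### The maximal pro-`l` quotient and `J[l]` ([AbsTopI] Prop 4.10 (iv) p. 60) -/

section ProL

variable (G : Type w) [Group G] [TopologicalSpace G]

/-- The kernel of the maximal pro-`l` quotient of a topological group `G`: the intersection of the
open normal subgroups of `G` of `l`-power index.  For profinite `G`, `G ⧸ proPrimeKer G l` is "the
maximal pro-`l` quotient" of [AbsTopI] Prop 4.10 (iv) p. 60. [cite: MochizukiAbsTopI2012, Prop 4.10 (iv) p.60] -/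
def proPrimeKer (l : ℕ) : Subgroup G :=
  ⨅ N : {N : OpenNormalSubgroup G // ∃ k : ℕ, (N : Subgroup G).index = l ^ k}, (N.1 : Subgroup G)

/-- The pro-`l` kernel is normal. [cite: MochizukiAbsTopI2012, Prop 4.10 (iv) p.60] -/
instance proPrimeKer_normal (l : ℕ) : (proPrimeKer G l).Normal :=
  Subgroup.normal_iInf_normal fun N => N.1.isNormal'

/-- The pro-`l` kernel is closed (an intersection of open, hence closed, subgroups).
[cite: MochizukiAbsTopI2012, Prop 4.10 (iv) p.60] -/
theorem isClosed_proPrimeKer [SeparatelyContinuousMul G] (l : ℕ) :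
    IsClosed (proPrimeKer G l : Set G) := by
  rw [proPrimeKer, Subgroup.coe_iInf]
  exact isClosed_iInter fun N => N.1.toOpenSubgroup.isClosed

/-- Every open normal subgroup of `l`-power index contains the pro-`l` kernel.
[cite: MochizukiAbsTopI2012, Prop 4.10 (iv) p.60] -/
theorem proPrimeKer_le {l : ℕ} (N : OpenNormalSubgroup G) (hN : ∃ k : ℕ, (N : Subgroup G).index = l ^ k) :
    proPrimeKer G l ≤ (N : Subgroup G) :=
  iInf_le (fun N : {N : OpenNormalSubgroup G // ∃ k : ℕ, (N : Subgroup G).index = l ^ k} =>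
    (N.1 : Subgroup G)) ⟨N, hN⟩

/-- The maximal pro-`l` quotient `G^{(l)} := G / proPrimeKer G l` of a topological group, with the
quotient topology. [cite: MochizukiAbsTopI2012, Prop 4.10 (iv) p.60] -/
abbrev MaxProQuot (l : ℕ) : Type w := G ⧸ proPrimeKer G l

/-- The projection `G ↠ G^{(l)}` onto the maximal pro-`l` quotient, a continuous homomorphism.
[cite: MochizukiAbsTopI2012, Prop 4.10 (iv) p.60] -/
def toMaxProQuot (l : ℕ) : G →ₜ* MaxProQuot G l where
  toMonoidHom := QuotientGroup.mk' (proPrimeKer G l)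
  continuous_toFun := QuotientGroup.continuous_mk

variable {G}

/-- `G ↠ G^{(l)}` is surjective. [cite: MochizukiAbsTopI2012, Prop 4.10 (iv) p.60] -/
theorem toMaxProQuot_surjective (l : ℕ) : Function.Surjective (toMaxProQuot G l) :=
  QuotientGroup.mk_surjective

variable {Phat : Type v} [Group Phat] [TopologicalSpace Phat] [IsTopologicalGroup Phat]

/-- **`J[l]`** ([AbsTopI] Prop 4.10 (iv) p. 60): "the co-free completion of `J` with respect to the
maximal pro-`l` quotient of the profinite completion of `J`" — for a topological group `J` (here the
type `P`) with given profinite-completion data `ι : J → Ĵ` (cf. the tempered interface's `toHat`), the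
`(Ĵ^{(l)}, J)`-co-free completion of `J` along `J → Ĵ ↠ Ĵ^{(l)}` (p. 60: co-free completions of open
subgroups of `Δ^{tp}_X` are taken "with respect to [the intersections [...] with] `Δ^{tp}_X`", which for
`J ⊆ Δ^{tp}_X` is `J` itself, whence `Δ := ⊤`). [cite: MochizukiAbsTopI2012, Prop 4.10 (iv) p.60] -/
def CoFreeProL (ι : P →ₜ* Phat) (l : ℕ) : Type (max u v) :=
  CoFreeCompletion ((toMaxProQuot Phat l).comp ι) (⊤ : Subgroup P)

/-- Group structure of `J[l]`. [cite: MochizukiAbsTopI2012, Prop 4.10 (iv) p.60] -/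
instance (ι : P →ₜ* Phat) (l : ℕ) : Group (CoFreeProL ι l) :=
  inferInstanceAs (Group (CoFreeCompletion ((toMaxProQuot Phat l).comp ι) (⊤ : Subgroup P)))

/-- Topology of `J[l]`. [cite: MochizukiAbsTopI2012, Prop 4.10 (iv) p.60] -/
instance (ι : P →ₜ* Phat) (l : ℕ) : TopologicalSpace (CoFreeProL ι l) :=
  inferInstanceAs (TopologicalSpace (CoFreeCompletion ((toMaxProQuot Phat l).comp ι) (⊤ : Subgroup P)))

/-- `J[l]` is a topological group whenever `J` is (v2 topology of the co-free completion: the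
inverse limit of the quotient topologies of `J`). [cite: MochizukiAbsTopI2012, Prop 4.10 (iv) p.60] -/
instance [IsTopologicalGroup P] (ι : P →ₜ* Phat) (l : ℕ) : IsTopologicalGroup (CoFreeProL ι l) :=
  inferInstanceAs (IsTopologicalGroup (CoFreeCompletion ((toMaxProQuot Phat l).comp ι) (⊤ : Subgroup P)))

/-- "write `J → J[l]`" ([AbsTopI] Prop 4.10 (iv) p. 60): the natural dense homomorphism.
[cite: MochizukiAbsTopI2012, Prop 4.10 (iv) p.60] -/
def toCoFreeProL (ι : P →ₜ* Phat) (l : ℕ) : P →ₜ* CoFreeProL ι l :=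
  toCoFreeCompletion ((toMaxProQuot Phat l).comp ι) (⊤ : Subgroup P)

/-- `J → J[l]` has dense image. [cite: MochizukiAbsTopI2012, Prop 4.10 (iv) p.60] -/
theorem denseRange_toCoFreeProL (ι : P →ₜ* Phat) (l : ℕ) : DenseRange (toCoFreeProL ι l) :=
  denseRange_toCoFreeCompletion _ _

end ProL

end Literature.AnabelianGeometry.AbsoluteAnabelian.AbsTopI
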